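import Summits.BirchSwinnertonDyer.Rank1Residual.Ordinary.KuriharaExactOrderVocabulary
import Summits.BirchSwinnertonDyer.Rank1Residual.X4.KimTamagawaDefect
import Literature.NumberTheory.EllipticCurves.Rank1Residual.Predicates
import Literature.NumberTheory.EllipticCurves.Kim2026.ShaLengthRankZeroKuriharaDivisibilityBound
import HarnessLib

/-!
# Cell conjecture C-16 (= C120.1, «C-2♯-r1 @ 3»): the RANK-ONE PER-LEVEL DEPTH LAW for Kurihara
# numbers at a good non-anomalous `p = 3` — TYPED as ONE `@[conjecture] def` (nothing asserted)

HONEST FRAMING (cell `b2b-bsdres`, run/shared/lean/b2b/bsd-rank1-residual/, verbatim in every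
file): the goal of the cell is to DELETE the COMBINATION-SHAPED residual classes of the
Birch–Swinnerton-Dyer formula for ALL analytic-rank `≤ 1` elliptic curves over `ℚ` — "full BSD
formula for every rank `≤ 1` curve in class `C`" assembled STRICTLY from published theorems — so
that the rank-`≤ 1` remainder becomes exactly the CONSTRUCTION-SHAPED classes, which are TYPED
(missing-input `Prop`s), NOT attempted. This is not "finishing BSD". A cell conjecture is a SENTENCE
suggested by PRE-REGISTERED DATA — DATA-SUGGESTED, NEVER A THEOREM, never a Literature fact, not a
kernel door; this file asserts NO arithmetic fact about any curve; it books nothing and moves no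
mark / label / count / tier (X7 / X8 stay CONSTRUCTION-SHAPED). Seat `b2b-bsdres-additive-p3` (instrument
of the rounds; typer-designate by the owner hyp GEN 104, INBOX l.16762 (5), cell lead ruling R-16 (e));
owner of the sentence / numbering / kill letter: hyp (`SHARPENED-CONJECTURES.md` §120 D94.4); count word
and honest limits: lit (`STRUCTURE.md` §2 / R-16); co-reader x10b.

## The sentence typed (hyp §120 D94.4, C120.1 = C-hyp-4 = C-16)

VERBATIM in the docstring of `KuriharaExactOrderRankOneAtThree` below. FALSIFIABLE per level by a finite
computation (KILL LETTER K-hyp-4: ONE level inside the hypotheses whose Kurihara number, certified by two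
independent computations, has `ord₃(δ̃_ℓ mod 3^k) ≠ min(k, FLOOR + 2·v_ℓ(P))`, `FLOOR := v₃ #Ш_an +
v₃ ∏ c_q`, retires the sentence). STATUS: OPEN CONJECTURE — [status: open]; DATA-SUGGESTED, NEVER
THEOREM; cell count of record `3 / 3` scored-HIT pre-registered designed rounds (ROUND 10 (B), ROUND 11,
ROUND 15 arm R3(a) + arm R3(b) = iw-2 UP5-R3; `STRUCTURE.md` R-16, token `conj:5-surviving`,
countersigned by the three referee desks).

## How each clause is spelled (tree vocabulary; the two ℕ-valued notions `localDivExponent` = `v_ℓ(P)`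
## and `zmodPowOrd` = `ord₃` on `ℤ/3^k` are the sibling file `Ordinary/KuriharaExactOrderVocabulary.lean`)

* `E/ℚ`: globally minimal `W : WeierstrassCurve ℚ`, `[W.IsElliptic] [W.IsGloballyMinimal]` (so `a_ℓ =
  W.frobeniusTrace ℓ`, `#Ẽ(𝔽_ℓ) = W.reductionPointCount ℓ`, `N = W.conductorNorm ℤ`); `W.analyticRank = 1`.
  `P` a generator of `E(ℚ)/tors`: `P : W.toAffine.Point` of infinite order, every rational point a
  multiple of `P` modulo torsion (`IsOfFinAddOrder`; in analytic rank `1`, `E(ℚ)/tors ≅ ℤ` by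
  Gross–Zagier–Kolyvagin, tree fact `rank_eq_analyticRank_of_analyticRank_le_one`).
* `3 ∤ #E(ℚ)_tors`: no rational point of order `3` (Cauchy; redundant under `ρ̄_{E,3}` onto, kept because
  printed). `ρ̄_{E,3}` onto: `W.HasSurjectiveModNGaloisRep 3`. `3` good and non-anomalous:
  `W.HasGoodReductionAtPrime 3` and, as printed, `a₃ ∉ {1, −2}` (`⟺ 3 ∤ #Ẽ(𝔽₃) = 4 − a₃`; supersingular
  `a₃ ∈ {0, ±3}` and ordinary `a₃ ∈ {−1, 2}` are both inside the letter).
* `m₃(P) = 0`: `¬ O5.PointLocallyThreeDivisibleAt W 3 P` — "`P` is not `3`-divisible in `E(ℚ₃)`" (the O5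
  lane's census predicate, `O5/SignedLevelRaisingTransferThree.lean` §3, reused). FAITHFUL under the
  sentence's own hypotheses: at a good non-anomalous `3`, `E(ℚ₃)[3^∞] = 0` (`E₁(ℚ₃) = Ê(3ℤ₃)` is
  torsion-free, AEC IV.6.1 / VII.3.1, and `E(ℚ₃)[3] ↪ Ẽ(𝔽₃)[3] = 0`), so `E(ℚ₃) ⊗ ℤ₃ ≅ ℤ₃` and
  `[E(ℚ₃) ⊗ ℤ₃ : ℤ₃·P] = 3^m`, `m = max {j : P ∈ 3^j E(ℚ₃)}` (prime-to-`3` torsion is `3`-divisible):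
  `m₃(P) = 0 ⟺ P ∉ 3·E(ℚ₃)`; no general `m₃` is needed for C-16 (C-17 = C120.2 drops the clause).
* `v₃ #Ш_an(E)`: the tree's `shaAn W` (Miller's analytic order of `Ш`) bound EXACTLY as in
  `Rank1Residual/X1RankOne.lean` and the owner's brief: `∃`/`∀ q : ℚ, shaAn W = q ∧ padicValRat 3 q = s` with
  `s : ℕ` (in analytic rank `1`, `#Ш_an` is a positive rational by Gross–Zagier; the instruments read
  Cremona's value; a curve with `v₃ #Ш_an < 0` is outside the sentence). `∏_q c_q = W.tamagawaProduct`.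
* `δ̃_ℓ` of `(E, 3^k, ℓ)`: the tree's `kuriharaNumber f (3^k) ℓ ψ ∈ ℤ/3^k` of the newform `f = D.f` of a
  datum `D : ModularParametrizationData W N`, for EVERY choice of surjective discrete logarithms `ψ` (two
  choices differ by a unit, `exists_units_kuriharaNumber_eq_mul`). The tree's symbols are
  `Ω⁺_f`-normalised, Kim's / the instruments' `Ω_E`-normalised: EXACTLY as every Kim-type item of the tree
  (`X4.kim2026_conjecture_1_10`, `Kim2026.rankZero_…`) the sentence carries the Manin clause `3 ∤ c_D` and
  the period-transfer clause `Ω(W) = u·Ω⁺_{D.f}`, `|u|₃ = 1` — a TRANSLATION clause (Kim 2022 §1.4.1's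
  standing hypothesis), not a hypothesis on `(E, ℓ, k)`; the period clause is word for word the
  conclusion of the tree's NAMED FACT `realPeriodRat_eq_unit_mul_plusPeriod_three`
  (`ModularCurvePeriodRatio.lean`; Greenberg–Vatsal 2000 Rem. 3.4 + Mazur 1978 Cor. 4.1 + Edixhoven 1991),
  whose hypotheses (good `3`, `E[3]` irreducible, `IsNewformOf W D.f`) hold inside C-16's — dischargeable
  BY NAME by a consumer holding that fact (owner's word, hyp GEN 109).
* cyclic depth-`k` Kolyvagin prime: `Kato.IsKolyvaginPrime W 3 k ℓ` (`ℓ ∤ 3N`, `ℓ ≡ 1`, `a_ℓ ≡ ℓ + 1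
  (mod 3^k)` ⟺ `3^k ∣ #Ẽ(𝔽_ℓ)`; `k ≤ k′_ℓ` automatic, `k′_ℓ` = the largest such `k`), `1 ≤ k`, and
  `IsCyclicKolyvaginLevel W 3 ℓ` (`#Ẽ(𝔽_ℓ)[3] ≤ 3` = "`E(𝔽_ℓ)[3^∞]` cyclic", `KuriharaNumberInvariants`).
* `v_ℓ(P)`: **`localDivExponent W 3 ℓ P`** (vocabulary file) — the largest `j ≤ e_ℓ = v₃ #Ẽ(𝔽_ℓ)` with `P`
  `3^j`-divisible in `E(ℚ_ℓ)`; PROVED equal (`localDivExponent_eq_findGreatest_reduction`) at a good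
  `ℓ ≠ 3` to the largest `j ≤ e_ℓ` with `P̄ ∈ 3^j Ẽ(𝔽_ℓ)` (AEC VII.2.1 / IV.2.3), which in a group whose
  `3`-Sylow is cyclic of order `3^{e_ℓ}` is the printed exponent of `P̄`'s `3`-primary component (`= e_ℓ`
  iff it is `O`, `= e_ℓ − v₃(ord P̄)` otherwise) — ONE point multiplication mod `ℓ` for the instruments.
* `ord₃(x)`, `x ∈ ℤ/3^k`: `zmodPowOrd 3 k x ∈ {0, …, k}` (vocabulary file): `k` if `x = 0`, else `v₃` of the
  representative `x.val ∈ [1, 3^k)` — the rounds' "exact order `3^m`" / "`9 ∥ δ̃_ℓ`"; blind to the unit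
  ambiguity of `ψ`, over which the sentence quantifies anyway.

## Contents

§1 the conjecture: parameter form `KuriharaExactOrderAt W f ℓ k P F` (the conclusion at one level with floor
`F`) and the closed sentence `KuriharaExactOrderRankOneAtThree` (both `@[conjecture] def … : Prop`, OPEN, nothing
asserted); §2 bookkeeping (proved: the
UNIT reading at `F = 0 ∧ v_ℓ(P) = 0`; the CAPPED reading `δ̃_ℓ ≡ 0 (mod 3^k)` when `F + 2·v_ℓ(P) ≥ k`; the
exact order otherwise); §3 LEVEL CONSISTENCY (proved): `ord₃` of a Kurihara number is blind to the choice of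
surjective logarithms, and the depth-`k′` clause implies every depth-`k ≤ k′` clause (`δ̃^{(k)} = δ̃^{(k′)} mod 3^k`, `Kim2026.castHom_kuriharaNumber`, + `zmodPowOrd_castHom`), so the
sentence's "for every `1 ≤ k ≤ k′_ℓ`" is ONE statement read modulo lower powers; §4 what C-16 would DELIVER
(proved implication): the typed input `X4.KuriharaUnitPrimeAt W 3 D.f` on every FLOOR-`0` pair with a
`v_ℓ(P) = 0` cyclic Kolyvagin prime. No Literature fact, no theorem about any curve, no `sorry`; standard axioms.

## Status in print, evidence, honest limits

NOT in print as a sentence (lit GEN 85 presearch + the registrant's): Kurihara 2014 / 2024 and Kim 2022 /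
2025 print min-over-levels / Fitting-ideal / `∂`-invariant statements only. Nearest printed: Kurihara
2024 (Tata Inst. Fund. Res. Stud. Math., zbl 1573.11168) Conj. 1.1 (`p ∤ Tam ⇒ ∃ n, δ_n ≠ 0`) and Conj. 1.3
(`δ_n ≠ 0 ⟺ r^Sel_n` bijective at `ν(n) = dim Sel(ℚ, E[p])`) — at `ν = 1`, rank one, `Ш[3] = 0`,
`3 ∤ Tam` the unit case `FLOOR = 0 ∧ v_ℓ(P) = 0` of C-16 (§2); Kim 2022 (Amer. J. Math. 2026 =
arXiv:2203.12159) Conj. 1.10 (`∂^{(∞)}(δ̃) = ∑ ord_p c_ℓ`, the Tamagawa half of FLOOR), Thm. 1.9 / 1.11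
(structure of Selmer groups / `Ш` from `δ̃`; arXiv vs journal numbering, see `KuriharaNumberKimStructure`),
Thm. 3.13 (`ord_p δ̃_n = ord loc^s_p κ_n − t`, `t = 0` at a good non-anomalous `p`; printed for `p ≥ 5`).
MECHANISM in the derived regime (`R1-DEPTH-LAW.md` §2, agreed by the owner §120 D94.3): Kato's Kolyvagin
system, `κ₁ = 3^{FLOOR}·u·P` (Mazur–Rubin Thm. 5.2.12), the Kolyvagin relation at `ℓ`, global reciprocity
for `κ_ℓ ∪ P̄`, Kim Thm. 3.13 — every input printed for `p ≥ 5` and used OUTSIDE its printed range, under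
the cell's OPEN Kim-2025@3 binder (WHY TWO: the generator enters inside `loc_ℓ κ₁` and again as the class
paired against). EVIDENCE (census-lead custody; nothing booked): P-5 ROUND 10 (A) 3 366 / 3 366
retrospective levels inside the hypotheses, (B) 157 / 157 designed, ROUND 11 37 / 37 on the open
`#Ш_an = 9` cells (`q = 81, 243`), ROUND 15 arm R3(a) (ORDINARY `3`, 76 fresh curves) 147 / 147 + arm R3(b)
(iw-2 UP5-R3, 805 fresh curves) 700 / 700 — records `Rank1Residual/Supersingular/KuriharaTwistRecordsK27…/
K81…RankOneDepthLaw*.lean`, `Rank1Residual/Ordinary/KuriharaTwistRecordsOrdinaryDepthLaw{J,…,N}.lean`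
(`CertifiedK` by `decide`); `0` against on every designed level; coefficient-`1` wording (N-25) `0 / 695`.
HONEST LIMITS (R-16): `p = 3` only; `ν = 1`; analytic rank one; non-anomalous good reduction (supersingular
`a₃ ∈ {0, ±3}`, ordinary `a₃ ∈ {−1, 2}`); conductors as registered per round (`N ≤ 5 150`); `k ≤ 5`; ONE
engine family (ENGINE K v1.3) with the in-job exact modular-symbol residue as second computation; `#Ш_an`
analytic. [evidence: census cell b2b-bsdres, P-5 ROUNDS 10 (B) / 11 / 15 R3(a) + UP5-R3 — PREREG-LEDGER]
References: hyp `SHARPENED-CONJECTURES.md` §119–§120, §129; lit `STRUCTURE.md` §2 C-16, R-16; additive-p3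
`R1-DEPTH-LAW.md`; Kim [Kim2022StructureSelmer]; Kurihara 2014 [Kurihara2014]; Kurihara 2024 (zbl
1573.11168); Mazur–Rubin [MazurRubin2004]; Silverman AEC VII.2–VII.3 [SilvermanAEC2009].
-/


noncomputable section

open scoped Classical MatrixGroups ModularForm

open CongruenceSubgroup WeierstrassCurve Literature.NumberTheory.EllipticCurves
  Literature.NumberTheory.EllipticCurves.ModularForms
  Literature.NumberTheory.EllipticCurves.Rank1Residual

open Literature.NumberTheory.EllipticCurves.Kim2026 (reduceLog reduceLog_surjective castHom_kuriharaNumber)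

namespace Summit.BirchSwinnertonDyer.Rank1Residual.Ordinary

/-! ### §1 The conjecture C-16 (typed; OPEN; nothing asserted) -/

section Conjecture

/-- **The rank-one depth law at ONE level, parameter form — `KuriharaExactOrderAt W f ℓ k P F`:
`ord₃(δ̃_ℓ mod 3^k) = min(k, F + 2·v_ℓ(P))`** for the Kurihara numbers `kuriharaNumber f (3^k) ℓ ψ` of
the cusp form `f` (the newform of `W` in every use) and EVERY choice of surjective discrete logarithms
`ψ_q : (ℤ/q)ˣ ↠ ℤ/3^k` at the primes `q ∣ ℓ` (two choices differ by a unit of `ℤ/3^k`,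
`exists_units_kuriharaNumber_eq_mul`, to which `ord₃` is blind), with `v_ℓ(P) = localDivExponent W 3 ℓ P`.
In C-16, `F = FLOOR = v₃ #Ш_an + v₃ ∏_q c_q`. The conclusion of hyp §120 C120.1 at `(E, P, ℓ, k)`; a
predicate on its parameters — OPEN CONJECTURE at the levels of C-16's letter, [status: open]; nothing
asserted. [cite: Kim2022StructureSelmer, §1.4.3 (PDF p. 7) and Thm. 3.13] -/
@[conjecture] def KuriharaExactOrderAt (W : WeierstrassCurve ℚ) [W.IsGloballyMinimal] {N : ℕ}
    (f : CuspForm (Gamma0 N) 2) (ℓ : ℕ) [Fact ℓ.Prime] (k : ℕ) (P : W.toAffine.Point) (F : ℕ) :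
    Prop :=
  ∀ ψ : (q : ℕ) → (ZMod q)ˣ →* Multiplicative (ZMod (3 ^ k)),
    (∀ q ∈ ℓ.primeFactors, Function.Surjective (ψ q)) →
      haveI : NeZero ℓ := ⟨(Fact.out : ℓ.Prime).ne_zero⟩
      zmodPowOrd 3 k (kuriharaNumber f (3 ^ k) ℓ ψ) = min k (F + 2 * localDivExponent W 3 ℓ P)

/-- **C-16 = C120.1 = «C-2♯-r1 @ 3» (hyp §120 D94.4; cell `STRUCTURE.md` §2 C-16) — THE RANK-ONE
PER-LEVEL DEPTH LAW FOR KURIHARA NUMBERS AT A GOOD NON-ANOMALOUS `p = 3`, TYPED.** OPEN CONJECTURE —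
[status: open]; DATA-SUGGESTED, NEVER THEOREM; nothing asserted. VERBATIM: «Let `E/ℚ` have analytic
rank `1`, `P` a generator of `E(ℚ)/tors`, `p = 3` with `3 ∤ #E(ℚ)_tors`, `ρ̄_{E,3}` onto (hence `E`
non-CM), `3` good and non-anomalous for `E` (`a₃ ∉ {1, −2}`) with `m₃(P) := v₃[E(ℚ₃) ⊗ ℤ₃ : ℤ₃·P] = 0`,
and `ℓ ∤ 3N` a cyclic depth-`k` Kolyvagin prime (`ℓ ≡ 1 mod 3^k`, `3^k ∣ #E(𝔽_ℓ)`, `E(𝔽_ℓ)[3^∞]`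
cyclic, `1 ≤ k ≤ k′_ℓ := min(v₃(ℓ − 1), v₃ #E(𝔽_ℓ))`). Then
`ord₃(δ̃_ℓ mod 3^k) = min(k, v₃ #Ш_an(E) + v₃ ∏_q c_q(E) + 2·v_ℓ(P))`, where `δ̃_ℓ` is the Kurihara
number of `(E, 3^k, ℓ)` and `v_ℓ(P)` is the `3`-divisibility exponent of `P̄` in the cyclic group
`E(𝔽_ℓ)[3^∞]` (`= e_ℓ := v₃ #E(𝔽_ℓ)` when `P̄`'s `3`-primary component is `O`).» Spelling of each
clause, kill letter K-hyp-4, count of record `3 / 3`, honest limits, evidence and nearest print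
(Kurihara 2024 Conj. 1.1 / 1.3; Kim 2022 Conj. 1.10 / Thm. 1.9 (1.11) / Thm. 3.13): module docstring;
conclusion = `KuriharaExactOrderAt W D.f ℓ k P (s + v₃ ∏ c_q)`, `s = v₃ #Ш_an`. [cite: Kim2022StructureSelmer, Conj. 1.10 (§1.5.3, PDF p. 8) and Thm. 3.13]
[cite: Kurihara2014, §1.1 (PDF p. 2)] -/
@[conjecture] def KuriharaExactOrderRankOneAtThree : Prop :=
  ∀ (W : WeierstrassCurve ℚ) [W.IsElliptic] [W.IsGloballyMinimal],
    W.analyticRank = 1 →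
    ∀ (P : W.toAffine.Point), ¬ IsOfFinAddOrder P →
      (∀ Q : W.toAffine.Point, ∃ n : ℤ, IsOfFinAddOrder (Q - n • P)) →
    (∀ T : W.toAffine.Point, 3 • T = 0 → T = 0) →
    W.HasSurjectiveModNGaloisRep 3 →
    W.HasGoodReductionAtPrime 3 → W.frobeniusTrace 3 ≠ 1 → W.frobeniusTrace 3 ≠ -2 →
    ¬ O5.PointLocallyThreeDivisibleAt W 3 P →
    ∀ (q : ℚ) (s : ℕ), shaAn W = (q : ℂ) → padicValRat 3 q = s →
    ∀ {N : ℕ} [NeZero N] (D : ModularParametrizationData W N),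
      ¬ (3 : ℤ) ∣ D.maninConstant →
      (∃ u : ℚ, ‖(u : ℚ_[3])‖ = 1 ∧ W.realPeriodRat = u * plusPeriod D.f) →
    ∀ (ℓ k : ℕ) [Fact ℓ.Prime], 1 ≤ k → Kato.IsKolyvaginPrime W 3 k ℓ →
      IsCyclicKolyvaginLevel W 3 ℓ →
      KuriharaExactOrderAt W D.f ℓ k P (s + padicValNat 3 W.tamagawaProduct)

end Conjecture

/-! ### §2 Bookkeeping: readings of the conclusion (proved; `KuriharaExactOrderAt` is a HYPOTHESIS here) -/

section Bookkeeping

variable (W : WeierstrassCurve ℚ) [W.IsGloballyMinimal] {N : ℕ} (f : CuspForm (Gamma0 N) 2)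
  (ℓ : ℕ) [Fact ℓ.Prime] (k : ℕ) (P : W.toAffine.Point)

/-- **The UNIT reading.** If the law holds at `(ℓ, k)` with `F = 0` (`3 ∤ #Ш_an · ∏ c_q`) and `v_ℓ(P) = 0`
(the generator's localisation at `ℓ` is onto `Ẽ(𝔽_ℓ) ⊗ ℤ/3`), EVERY mod-`3^k` Kurihara number at `ℓ` is a
UNIT of `ℤ/3^k` (`k ≥ 1`) — the `ν = 1` rank-one instance of the "if" half of Kurihara 2024 Conj. 1.3
inside C-16 (the rounds' designed `v = 0` units). [cite: Kim2022StructureSelmer, §1.4.3 (PDF p. 7)] -/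
theorem isUnit_kuriharaNumber_of_kuriharaExactOrderAt_zero (hk : 1 ≤ k)
    (hlaw : KuriharaExactOrderAt W f ℓ k P 0) (hv : localDivExponent W 3 ℓ P = 0)
    (ψ : (q : ℕ) → (ZMod q)ˣ →* Multiplicative (ZMod (3 ^ k)))
    (hψ : ∀ q ∈ ℓ.primeFactors, Function.Surjective (ψ q)) :
    haveI : NeZero ℓ := ⟨(Fact.out : ℓ.Prime).ne_zero⟩
    IsUnit (kuriharaNumber f (3 ^ k) ℓ ψ) := by
  haveI : NeZero ℓ := ⟨(Fact.out : ℓ.Prime).ne_zero⟩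
  have h := hlaw ψ hψ
  rw [hv, mul_zero, add_zero, Nat.min_zero] at h
  have hne : kuriharaNumber f (3 ^ k) ℓ ψ ≠ 0 := by
    intro h0
    rw [h0, zmodPowOrd_zero] at h
    omega
  have hnd : ¬ 3 ∣ (kuriharaNumber f (3 ^ k) ℓ ψ).val :=
    (zmodPowOrd_eq_zero_iff_of_ne_zero (by norm_num) hne).mp h
  have hcop : Nat.Coprime (kuriharaNumber f (3 ^ k) ℓ ψ).val (3 ^ k) :=
    Nat.Coprime.pow_right k ((Nat.Prime.coprime_iff_not_dvd Nat.prime_three).mpr hnd).symm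
  haveI : NeZero (3 ^ k) := ⟨pow_ne_zero k (by norm_num)⟩
  have hu := (ZMod.unitOfCoprime _ hcop).isUnit
  rwa [ZMod.coe_unitOfCoprime, ZMod.natCast_zmod_val] at hu

/-- **The CAPPED reading.** If the law holds at `(ℓ, k)` with `F + 2·v_ℓ(P) ≥ k`, every mod-`3^k` Kurihara
number at `ℓ` VANISHES (the rounds' "`≡ 0 (mod 27)`" cells; why a floor reading wants `v_ℓ(P) = 0` primes).
[cite: Kim2022StructureSelmer, §1.4.3 (PDF p. 7)] -/
theorem kuriharaNumber_eq_zero_of_kuriharaExactOrderAt_of_le {F : ℕ}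
    (hlaw : KuriharaExactOrderAt W f ℓ k P F) (hcap : k ≤ F + 2 * localDivExponent W 3 ℓ P)
    (ψ : (q : ℕ) → (ZMod q)ˣ →* Multiplicative (ZMod (3 ^ k)))
    (hψ : ∀ q ∈ ℓ.primeFactors, Function.Surjective (ψ q)) :
    haveI : NeZero ℓ := ⟨(Fact.out : ℓ.Prime).ne_zero⟩
    kuriharaNumber f (3 ^ k) ℓ ψ = 0 := by
  haveI : NeZero ℓ := ⟨(Fact.out : ℓ.Prime).ne_zero⟩
  have h := hlaw ψ hψ
  rw [min_eq_left hcap] at h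
  exact (zmodPowOrd_eq_iff_eq_zero (by norm_num) _).mp h

/-- **The UNCAPPED reading is an exact order.** If the law holds at `(ℓ, k)` with `F + 2·v_ℓ(P) < k`, every
mod-`3^k` Kurihara number at `ℓ` is NON-ZERO with `v₃(val) = F + 2·v_ℓ(P)` — the LAW-discriminating levels
(coefficient `2`: `9 ∥ δ̃_ℓ` at `v = 1`, `F = 0`, `q = 27`). [cite: Kim2022StructureSelmer, §1.4.3 (PDF p. 7)] -/
theorem kuriharaNumber_ne_zero_of_kuriharaExactOrderAt_of_lt {F : ℕ}
    (hlaw : KuriharaExactOrderAt W f ℓ k P F) (hlt : F + 2 * localDivExponent W 3 ℓ P < k)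
    (ψ : (q : ℕ) → (ZMod q)ˣ →* Multiplicative (ZMod (3 ^ k)))
    (hψ : ∀ q ∈ ℓ.primeFactors, Function.Surjective (ψ q)) :
    haveI : NeZero ℓ := ⟨(Fact.out : ℓ.Prime).ne_zero⟩
    kuriharaNumber f (3 ^ k) ℓ ψ ≠ 0 ∧
      padicValNat 3 (kuriharaNumber f (3 ^ k) ℓ ψ).val = F + 2 * localDivExponent W 3 ℓ P := by
  haveI : NeZero ℓ := ⟨(Fact.out : ℓ.Prime).ne_zero⟩
  have h := hlaw ψ hψ
  rw [min_eq_right hlt.le] at h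
  have hne : kuriharaNumber f (3 ^ k) ℓ ψ ≠ 0 := by
    intro h0
    rw [h0, zmodPowOrd_zero] at h
    omega
  exact ⟨hne, by rwa [zmodPowOrd_of_ne_zero hne] at h⟩

end Bookkeeping

/-! ### §3 Level consistency (proved): the depth-`k′` clause implies the depth-`k` clauses, `k ≤ k′` -/

section Levels

variable (W : WeierstrassCurve ℚ) [W.IsElliptic] [W.IsGloballyMinimal] {N : ℕ} [NeZero N]
  (D : ModularParametrizationData W N) (ℓ : ℕ) [Fact ℓ.Prime] (P : W.toAffine.Point)

/-- **`ord₃` of a Kurihara number does not depend on the surjective discrete logarithms.**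
[cite: Kim2022StructureSelmer, §1.4.3 (PDF p. 7)] -/
theorem zmodPowOrd_kuriharaNumber_eq_of_surjective {k : ℕ} {M : ℕ} (f : CuspForm (Gamma0 M) 2)
    {ψ₁ ψ₂ : (q : ℕ) → (ZMod q)ˣ →* Multiplicative (ZMod (3 ^ k))}
    (h₁ : ∀ q ∈ ℓ.primeFactors, Function.Surjective (ψ₁ q))
    (h₂ : ∀ q ∈ ℓ.primeFactors, Function.Surjective (ψ₂ q)) :
    haveI : NeZero ℓ := ⟨(Fact.out : ℓ.Prime).ne_zero⟩
    zmodPowOrd 3 k (kuriharaNumber f (3 ^ k) ℓ ψ₂) = zmodPowOrd 3 k (kuriharaNumber f (3 ^ k) ℓ ψ₁) := by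
  haveI : NeZero ℓ := ⟨(Fact.out : ℓ.Prime).ne_zero⟩
  obtain ⟨u, hu⟩ := exists_units_kuriharaNumber_eq_mul f (3 ^ k) ℓ h₁ h₂
  rw [hu]
  exact zmodPowOrd_mul_of_isUnit Nat.prime_three u.isUnit _

/-- **LEVEL CONSISTENCY of the typed law: the depth-`k′` clause implies every depth-`k ≤ k′` clause.**
If `KuriharaExactOrderAt W D.f ℓ k′ P F` holds and `ℓ ∈ 𝒫_{k′}` (`Kato.IsKolyvaginPrime W 3 k′ ℓ`), then
`KuriharaExactOrderAt W D.f ℓ k P F` for every `k ≤ k′` — because `δ̃_ℓ^{(k)} = δ̃_ℓ^{(k′)} mod 3^k`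
(`Kim2026.castHom_kuriharaNumber`; the symbols `[a/ℓ]⁺` are `3`-integral since `E[3]` is irreducible and
`ℓ ∤ N`, `IsNewformOf.not_dvd_den_ratPlusSymbol_div`) and `ord₃` of a reduction is the capped `ord₃`
(`zmodPowOrd_castHom`): `min(k, min(k′, F + 2v)) = min(k, F + 2v)`. So C-16's quantification "for every
`1 ≤ k ≤ k′_ℓ`" is internally consistent: it is the depth-`k′_ℓ` statement read modulo lower powers.
Hypotheses: `E[3]` irreducible (implied by `ρ̄_{E,3}` onto), the datum's level is the conductor.
[cite: Kim2022StructureSelmer, §1.4.3 and §1.5.1 (PDF p. 7)] -/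
theorem kuriharaExactOrderAt_of_le (hN : W.conductorNorm ℤ = N) (hirr : W.HasIrreducibleModPGaloisRep 3)
    {k k' : ℕ} (hkk' : k ≤ k') (hℓ : Kato.IsKolyvaginPrime W 3 k' ℓ) {F : ℕ}
    (h : KuriharaExactOrderAt W D.f ℓ k' P F) : KuriharaExactOrderAt W D.f ℓ k P F := by
  haveI : NeZero ℓ := ⟨(Fact.out : ℓ.Prime).ne_zero⟩
  have hℓp : ℓ.Prime := Fact.out
  intro ψ hψ
  -- a surjective family of discrete logarithms at level `3^k'`
  have h1 : 1 ≤ ℓ := hℓp.one_lt.le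
  have hdvd1 : 3 ^ k' ∣ ℓ - 1 := (Nat.modEq_iff_dvd' h1).mp hℓ.modEq_one.symm
  obtain ⟨ψ', hψ'⟩ := exists_surjective_unitsHom hℓp hdvd1
  let Ψ : (q : ℕ) → (ZMod q)ˣ →* Multiplicative (ZMod (3 ^ k')) :=
    Function.update (fun q => (1 : (ZMod q)ˣ →* Multiplicative (ZMod (3 ^ k')))) ℓ ψ'
  have hΨℓ : Ψ ℓ = ψ' := Function.update_self ..
  have hΨ : ∀ q ∈ ℓ.primeFactors, Function.Surjective (Ψ q) := by
    intro q hq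
    rw [Nat.Prime.primeFactors hℓp, Finset.mem_singleton] at hq
    subst hq
    rw [hΨℓ]
    exact hψ'
  -- the law at level `k'` for `Ψ`
  have hk' := h Ψ hΨ
  -- level reduction `3^k' → 3^k`
  have hdvd : 3 ^ k ∣ 3 ^ k' := pow_dvd_pow 3 hkk'
  have hcopN : ℓ.Coprime N := by
    have := hℓ.coprime
    rw [hN] at this
    exact Nat.Coprime.coprime_dvd_right (dvd_mul_right N 3) this
  have hden : ∀ a : ℕ, (ratPlusSymbol D.f ((a : ℚ) / ℓ)).den.Coprime (3 ^ k') := by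
    intro a
    have hnd := D.isNewformOf.not_dvd_den_ratPlusSymbol_div (by norm_num) hirr hcopN (a : ℤ)
    rw [Int.cast_natCast] at hnd
    exact Nat.Coprime.pow_right k'
      (Nat.coprime_comm.mp ((Nat.Prime.coprime_iff_not_dvd Nat.prime_three).mpr hnd))
  have hred : kuriharaNumber D.f (3 ^ k) ℓ (reduceLog hdvd Ψ) =
      ZMod.castHom hdvd (ZMod (3 ^ k)) (kuriharaNumber D.f (3 ^ k') ℓ Ψ) :=
    (castHom_kuriharaNumber D.f hdvd ℓ Ψ hden).symm
  have hΨred : ∀ q ∈ ℓ.primeFactors, Function.Surjective (reduceLog hdvd Ψ q) :=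
    fun q hq => reduceLog_surjective hdvd (hΨ q hq)
  -- `ord₃` is blind to the choice of logarithms, and capped under reduction
  rw [zmodPowOrd_kuriharaNumber_eq_of_surjective ℓ D.f hΨred hψ, hred, zmodPowOrd_castHom Nat.prime_three hkk',
    hk', ← min_assoc, min_eq_left hkk']

end Levels

/-! ### §4 What the sentence would deliver (proved implication; C-16 is the HYPOTHESIS `hC`) -/

section Consumer

/-- **C-16 ⟹ the typed input `X4.KuriharaUnitPrimeAt W 3 D.f` of the cell's rank-one Kurihara route on
every FLOOR-`0` pair (`v₃ #Ш_an = 0`, `3 ∤ ∏ c_q`) of its letter that has a cyclic Kolyvagin prime `ℓ ∈ 𝒫₁`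
with `v_ℓ(P) = 0`** (such
primes have Chebotarev density `2/3` among the cyclic Kolyvagin primes — NOT proved here: the prime is a
hypothesis; the rounds' 793 designed `v = 0` levels are instances): at `k = 1` the law reads `ord₃ δ̃_ℓ = 0`,
i.e. a UNIT mod-`3` Kurihara number at a prime cyclic level (`isUnit_kuriharaNumber_of_kuriharaExactOrderAt_zero`).
At `p = 3` that input's consumers stay conditional on the cell's OPEN Kim-2025@3 binder; nothing is booked.
[cite: Kim2022StructureSelmer, Thm. 1.9 (1)/(6) and §1.4.3 (PDF pp. 7–8)] -/
theorem kuriharaUnitPrimeAt_three_of_kuriharaExactOrderRankOne (hC : KuriharaExactOrderRankOneAtThree)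
    (W : WeierstrassCurve ℚ) [W.IsElliptic] [W.IsGloballyMinimal] (hr : W.analyticRank = 1)
    (P : W.toAffine.Point) (hP : ¬ IsOfFinAddOrder P)
    (hgen : ∀ Q : W.toAffine.Point, ∃ n : ℤ, IsOfFinAddOrder (Q - n • P))
    (htors : ∀ T : W.toAffine.Point, 3 • T = 0 → T = 0) (hsurj : W.HasSurjectiveModNGaloisRep 3)
    (hgood : W.HasGoodReductionAtPrime 3) (ha1 : W.frobeniusTrace 3 ≠ 1) (ha2 : W.frobeniusTrace 3 ≠ -2)
    (hm : ¬ O5.PointLocallyThreeDivisibleAt W 3 P) {q : ℚ} (hq : shaAn W = (q : ℂ))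
    (hq0 : padicValRat 3 q = 0) (htam : ¬ 3 ∣ W.tamagawaProduct) {N : ℕ} [NeZero N] (D : ModularParametrizationData W N)
    (hc : ¬ (3 : ℤ) ∣ D.maninConstant)
    (hper : ∃ u : ℚ, ‖(u : ℚ_[3])‖ = 1 ∧ W.realPeriodRat = u * plusPeriod D.f)
    (ℓ : ℕ) [Fact ℓ.Prime] (hℓ : Kato.IsKolyvaginPrime W 3 1 ℓ) (hcyc : IsCyclicKolyvaginLevel W 3 ℓ)
    (hv : localDivExponent W 3 ℓ P = 0) : X4.KuriharaUnitPrimeAt W 3 D.f := by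
  have hℓp : ℓ.Prime := Fact.out
  haveI : NeZero ℓ := ⟨hℓp.ne_zero⟩
  -- the law at `(ℓ, k = 1)` with floor `v₃ S + v₃ ∏ c_q = 0`
  have hlaw := hC W hr P hP hgen htors hsurj hgood ha1 ha2 hm q 0 hq (by rw [hq0, Nat.cast_zero]) D hc
    hper ℓ 1 le_rfl hℓ hcyc
  rw [padicValNat.eq_zero_of_not_dvd htam, add_zero] at hlaw
  -- a surjective discrete logarithm at `ℓ` modulo `3`
  have hdvd1 : 3 ^ 1 ∣ ℓ - 1 := (Nat.modEq_iff_dvd' hℓp.one_lt.le).mp hℓ.modEq_one.symm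
  obtain ⟨ψ', hψ'⟩ := exists_surjective_unitsHom hℓp hdvd1
  let Ψ : (q : ℕ) → (ZMod q)ˣ →* Multiplicative (ZMod (3 ^ 1)) :=
    Function.update (fun q => (1 : (ZMod q)ˣ →* Multiplicative (ZMod (3 ^ 1)))) ℓ ψ'
  have hΨℓ : Ψ ℓ = ψ' := Function.update_self ..
  have hΨ : ∀ q ∈ ℓ.primeFactors, Function.Surjective (Ψ q) := by
    intro q hq
    rw [Nat.Prime.primeFactors hℓp, Finset.mem_singleton] at hq
    subst hq
    rw [hΨℓ]
    exact hψ'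
  have hunit := isUnit_kuriharaNumber_of_kuriharaExactOrderAt_zero W D.f ℓ 1 P le_rfl hlaw hv Ψ hΨ
  haveI : Nontrivial (ZMod (3 ^ 1)) := by
    rw [pow_one]; exact ZMod.nontrivial_iff.mpr (by norm_num)
  refine ⟨ℓ, inferInstance, hℓ, hcyc.2 ℓ dvd_rfl, Ψ, ?_, hunit.ne_zero⟩
  rw [hΨℓ]
  exact hψ'

end Consumer

end Summit.BirchSwinnertonDyer.Rank1Residual.Ordinary

end
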